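import Summits.Ventures.HodgeRepro2.T5RecordJointTwentyOne
import Summits.Ventures.HodgeRepro2.T5CyclotomicInfinitelyManyPlaces
import Summits.Ventures.HodgeRepro2.T5CyclotomicTwentyOneSatake
import Summits.Ventures.HodgeRepro2.T5PrimeOverPlace

/-!
# Joint consistency at infinitely many places of the NON-cyclotomic sextic Galois CM field `F = ℚ(ζ₂₁)^{⟨σ₁₃⟩}`

Tier-5 support N3 / §G-N4.2 (seat p3, gen 88). The `F` companion of files 360 / 361: file 363 proved the joint
statement of file 356 at every place of `F⁺` above every prime `p ≡ 2 (mod 21)` with the places given as hypotheses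
(`P ∣ p` in `F`, `v` under `P`); here the places are CONSTRUCTED and counted. By Dirichlet (file 290's
`infinite_setOf_prime_eq_mod 2`) the primes `p ≡ 2 (mod 21)` are infinite; the record's `placeAboveCyc` (the chosen
place of `F⁺` above `p`, injective in `p`) indexes a place `v_p` of `F⁺` by each of them; a prime `P` of `F` above
`v_p` is chosen with file 367's `primeOverPlace` (Mathlib's `Ideal.nonempty_primesOver`), so that file 290's
`exists_map_eq_of_eq_two_mod` supplies `w` with `v_p 𝓞_F = w`. Hence:

* `vTwoModOf` — the chosen place of `F⁺` above each prime `p ≡ 2 (mod 21)`; `vTwoModOf_injective`,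
  `liesOver_vTwoModOf`, `natCast_mem_vTwoModOf`, `exists_map_eq_vTwoModOf` (`v_p` stays prime in `F`),
  `inertiaDeg_vTwoModOf` (`f(v_p/p) = 3`) and `absNorm_vTwoModOf` (`N(v_p) = p³`, the `q` of the local pair);
* **`infinite_setOf_joint_twentyOne`** — the set of places `v` of `F⁺` above a prime `p ≡ 2 (mod 21)`, staying prime
  in `F` (`v 𝓞_F = w`), at which the lattice-model data for `diag(1, 1, −1)` over `vRat p` AND the unramified
  spectrum of the record's pair (Satake parameter `α · N(v)⁻² = α · p⁻⁶`) hold, is INFINITE.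

The set predicate is byte-for-byte the conclusion of file 363's `joint_twentyOne_two_mod` (with `@vRat p hp` for the
`∃`-bound prime); the `LiesOver` instances are bound by explicit terms in the predicate and passed explicitly in the
proof (annex §101(b)). §8(d): uses an L-value-free non-vanishing device: NO.
-/
open Matrix NumberField NumberField.IsCMField IsDedekindDomain IsDedekindDomain.HeightOneSpectrum Module
  MulAction
open scoped TensorProduct Pointwise
open Summit.Ventures.HodgeRepro2.T5UnitaryGroupForm Summit.Ventures.HodgeRepro2.T5UnitaryHeckeAdjoint
  Summit.Ventures.HodgeRepro2.T5HeckePermutationModule Summit.Ventures.HodgeRepro2.LevelPositivity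
  Summit.Ventures.HodgeRepro2.T5LevelIdempotent Summit.Ventures.HodgeRepro2.T5StarOfInvolution
  Summit.Ventures.HodgeRepro2.T5FinitePlaceCM Summit.Ventures.HodgeRepro2.T5NonSplitPlaceUnitaryGroup
  Summit.Ventures.HodgeRepro2.T5RecordHyperspecial Summit.Ventures.HodgeRepro2.T5GlobalLatticeAlmostAll
  Summit.Ventures.HodgeRepro2.T5HermitianThreeElements Summit.Ventures.HodgeRepro2.T5GaloisCartanThree
  Summit.Ventures.HodgeRepro2.T5InertDegreeGalois Summit.Ventures.HodgeRepro2.T5InertPlaceCompletion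
  Summit.Ventures.HodgeRepro2.T5InertDegreeAdicCompletion Summit.Ventures.HodgeRepro2.T5InertSatakeTransform
  Summit.Ventures.HodgeRepro2.T5InertSatakeTransformCompletion Summit.Ventures.HodgeRepro2.T5InertUnipotentResidue
  Summit.Ventures.HodgeRepro2.T5InertSphericalSubquotient Summit.Ventures.HodgeRepro2.T5RecordSatakeCell
  Summit.Ventures.HodgeRepro2.T5SplitPlaceUnitaryGroup Summit.Ventures.HodgeRepro2.T5FinitePlaceNormIndex
  Summit.Ventures.HodgeRepro2.T5HermitianLocalIsotropyN3 Summit.Ventures.HodgeRepro2.T5FinitePlaceSplitClassification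
  Summit.Ventures.HodgeRepro2.T5InertDegreeCompletion Summit.Ventures.HodgeRepro2.T5InertPlaceCompletionCells
  Summit.Ventures.HodgeRepro2.T5RecordSatake Summit.Ventures.HodgeRepro2.T5CartanCellsDistinct
  Summit.Ventures.HodgeRepro2.T5RecordSatakeInert Summit.Ventures.HodgeRepro2.T5InertGlobalPrime
  Summit.Ventures.HodgeRepro2.T5CMFieldSquareDatum Summit.Ventures.HodgeRepro2.T5RecordSatakeDegree
  Summit.Ventures.HodgeRepro2.T5RecordSatakeDegreeIntrinsic Summit.Ventures.HodgeRepro2.T5RecordSphericalSpectrum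
  Summit.Ventures.HodgeRepro2.T5RecordSphericalSpectrumIntrinsic Summit.Ventures.HodgeRepro2.T5RecordSatakeToy
  Summit.Ventures.HodgeRepro2.T5RecordSphericalSpectrumDatumFree
  Summit.Ventures.HodgeRepro2.T5AdditiveConductor Summit.Ventures.HodgeRepro2.T5UnitaryGroupIsometry
  Summit.Ventures.HodgeRepro2.T5ConductorDualLattice Summit.Ventures.HodgeRepro2.T5ConductorDualLatticeSplit
  Summit.Ventures.HodgeRepro2.T5SplitHermitianClass Summit.Ventures.HodgeRepro2.T5RecordLatticeModelOutsideDiscriminant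
  Summit.Ventures.HodgeRepro2.T5RecordLatticeModelSeven Summit.Ventures.HodgeRepro2.T5RecordJointOutsideDiscriminant
  Summit.Ventures.HodgeRepro2.T5RationalPlace Summit.Ventures.HodgeRepro2.T5DiscriminantUnramified
  Summit.Ventures.HodgeRepro2.T5CyclotomicTwentyOneSextic Summit.Ventures.HodgeRepro2.T5CyclotomicTwentyOneCensus
  Summit.Ventures.HodgeRepro2.T5CyclotomicTwentyOneTable Summit.Ventures.HodgeRepro2.T5CyclotomicSevenHeckeCommutative
  Summit.Ventures.HodgeRepro2.T5RecordJointTwentyOne Summit.Ventures.HodgeRepro2.T5CyclotomicInfinitelyManyPlaces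
  Summit.Ventures.HodgeRepro2.T5CyclotomicSevenSplitPrime Summit.Ventures.HodgeRepro2.T5CyclotomicTwentyOneSatake
  Summit.Ventures.HodgeRepro2.T5PrimeOverPlace

namespace Summit.Ventures.HodgeRepro2.T5RecordJointTwentyOneInfinitelyMany

universe uV

section TwentyOne

variable (L : Type*) [Field L] [NumberField L] [IsCyclotomicExtension {21} ℚ L]
variable (k : Type*) [Field k] [CharZero k] [IsAlgClosed k]

/-- The chosen place of `F⁺` above each prime `p ≡ 2 (mod 21)` (the record's `placeAboveCyc` on `F`). -/
noncomputable def vTwoModOf (p : {p : ℕ // p.Prime ∧ p % 21 = 2}) :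
    HeightOneSpectrum (𝓞 (maximalRealSubfield (fixedField L))) :=
  placeAboveCyc (fixedField L) p.1 (hp := ⟨p.2.1⟩)

/-- Distinct primes give distinct places (`placeAboveCyc_injective_of_prime`). -/
theorem vTwoModOf_injective : Function.Injective (vTwoModOf L) := fun p q h =>
  Subtype.ext (placeAboveCyc_injective_of_prime (fixedField L) p.2.1 q.2.1 h)

/-- `v_p` lies above `(p)`. -/
theorem liesOver_vTwoModOf (p : {p : ℕ // p.Prime ∧ p % 21 = 2}) :
    (vTwoModOf L p).asIdeal.LiesOver (Ideal.span {(p.1 : ℤ)}) :=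
  liesOver_placeAboveCyc (fixedField L) p.1 (hp := ⟨p.2.1⟩)

/-- `p ∈ v_p`. -/
theorem natCast_mem_vTwoModOf (p : {p : ℕ // p.Prime ∧ p % 21 = 2}) :
    (p.1 : 𝓞 (maximalRealSubfield (fixedField L))) ∈ (vTwoModOf L p).asIdeal :=
  haveI := liesOver_vTwoModOf L p
  natCast_mem_of_liesOver (maximalRealSubfield (fixedField L)) p.1 (vTwoModOf L p).asIdeal

/-- **`v_p` stays prime in `F`** (`p ≡ 2 (mod 21)` is inert of degree `6`, file 290): the place `w` of `F` with
`v_p 𝓞_F = w` exists — through the chosen prime `primeOverPlace F v_p` of `F` above `v_p` (file 367). -/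
theorem exists_map_eq_vTwoModOf (p : {p : ℕ // p.Prime ∧ p % 21 = 2}) :
    ∃ w : HeightOneSpectrum (𝓞 (fixedField L)),
      Ideal.map (algebraMap (𝓞 (maximalRealSubfield (fixedField L))) (𝓞 (fixedField L))) (vTwoModOf L p).asIdeal =
        w.asIdeal :=
  haveI : Fact p.1.Prime := ⟨p.2.1⟩
  haveI := liesOver_vTwoModOf L p
  haveI := primeOverPlace_isPrime (fixedField L) (vTwoModOf L p)
  haveI := primeOverPlace_liesOver (fixedField L) (vTwoModOf L p)
  haveI := primeOverPlace_liesOver_int (fixedField L) p.1 (vTwoModOf L p)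
  (exists_map_eq_of_eq_two_mod L p.1 p.2.2 (primeOverPlace (fixedField L) (vTwoModOf L p)).1 (vTwoModOf L p)).2

/-- **`f(v_p / p) = 3`**: the chosen prime `P` of `F` above `v_p` has `f(P/p) = 6` (file 290) and
`f(P/p) = 2 · f(v_p/p)` (file 291's `inertiaDeg_under_eq`, the even case). -/
theorem inertiaDeg_vTwoModOf (p : {p : ℕ // p.Prime ∧ p % 21 = 2}) :
    (vTwoModOf L p).asIdeal.inertiaDeg ℤ = 3 := by
  haveI : Fact p.1.Prime := ⟨p.2.1⟩
  haveI := liesOver_vTwoModOf L p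
  haveI := primeOverPlace_isPrime (fixedField L) (vTwoModOf L p)
  haveI := primeOverPlace_liesOver (fixedField L) (vTwoModOf L p)
  haveI := primeOverPlace_liesOver_int (fixedField L) p.1 (vTwoModOf L p)
  have h6 : (primeOverPlace (fixedField L) (vTwoModOf L p)).1.inertiaDeg ℤ = 6 :=
    (exists_map_eq_of_eq_two_mod L p.1 p.2.2 (primeOverPlace (fixedField L) (vTwoModOf L p)).1 (vTwoModOf L p)).1
  have h2 := inertiaDeg_under_eq L p.1
    ((Nat.Prime.coprime_iff_not_dvd p.2.1).mpr (not_dvd_twentyOne_of_two_mod p.1 p.2.2))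
    (primeOverPlace (fixedField L) (vTwoModOf L p)).1 (vTwoModOf L p) (by rw [h6]; decide)
  omega

/-- **`N(v_p) = p³`** — the `q` of the record's local pair at `v_p`: the Satake parameter of the joint statement is
`α · N(v_p)⁻² = α · p⁻⁶`. -/
theorem absNorm_vTwoModOf (p : {p : ℕ // p.Prime ∧ p % 21 = 2}) :
    Ideal.absNorm (vTwoModOf L p).asIdeal = p.1 ^ 3 := by
  haveI : Fact p.1.Prime := ⟨p.2.1⟩
  haveI := liesOver_vTwoModOf L p
  rw [← Ideal.pow_inertiaDeg p.1 (vTwoModOf L p).asIdeal, inertiaDeg_vTwoModOf]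

/-- **AT INFINITELY MANY PLACES OF `F⁺` THE JOINT STATEMENT HOLDS** (`F = ℚ(ζ₂₁)^{⟨σ₁₃⟩}`, the record's
non-cyclotomic sextic Galois CM field): the set of places `v` above a prime `p ≡ 2 (mod 21)`, staying prime
(`v 𝓞_F = w`), at which the lattice-model data for `diag(1, 1, −1)` over `vRat p` AND the unramified spectrum of the
record's pair (Satake parameter `α · N(v)⁻² = α · p⁻⁶`) hold, is infinite. -/
theorem infinite_setOf_joint_twentyOne :
    haveI := isCMField_fixedField L
    {v : HeightOneSpectrum (𝓞 (maximalRealSubfield (fixedField L))) |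
      ∃ (p : ℕ) (hp : Fact p.Prime) (_h2 : p % 21 = 2) (hmem : (p : 𝓞 (maximalRealSubfield (fixedField L))) ∈ v.asIdeal)
        (w : HeightOneSpectrum (𝓞 (fixedField L)))
        (hmap : Ideal.map (algebraMap (𝓞 (maximalRealSubfield (fixedField L))) (𝓞 (fixedField L))) v.asIdeal = w.asIdeal),
        letI : v.asIdeal.LiesOver (@vRat p hp).asIdeal := @liesOver_vRat_of_mem p hp _ _ _ v hmem
        letI := liesOver_of_map_eq (fixedField L) v w hmap
        ((∃ ψ : AddChar ((@vRat p hp).adicCompletion ℚ) Circle, Continuous ψ ∧ (∃ y, ψ y ≠ 1) ∧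
          conductorExp ψ (Valued.v : Valuation ((@vRat p hp).adicCompletion ℚ) (WithZero (Multiplicative ℤ))) = 0 ∧
          conductorExp (ψ.compAddMonoidHom
            (Algebra.trace ((@vRat p hp).adicCompletion ℚ) (v.adicCompletion (maximalRealSubfield (fixedField L)))).toAddMonoidHom)
            (Valued.v : Valuation (v.adicCompletion (maximalRealSubfield (fixedField L))) (WithZero (Multiplicative ℤ))) = 0) ∧
        ∀ (ψ : AddChar ((@vRat p hp).adicCompletion ℚ) Circle), Continuous ψ → (∃ y, ψ y ≠ 1) →
          conductorExp ψ (Valued.v : Valuation ((@vRat p hp).adicCompletion ℚ) (WithZero (Multiplicative ℤ))) = 0 →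
          ∀ (w' : HeightOneSpectrum (𝓞 (fixedField L))) [w'.asIdeal.LiesOver v.asIdeal],
            v.asIdeal.ramificationIdx' w'.asIdeal = 1 ∧
            conductorExp (recordChar (fixedField L) (@vRat p hp) v w' ψ)
              (Valued.v : Valuation (w'.adicCompletion (fixedField L)) (WithZero (Multiplicative ℤ))) = 0 ∧
            (∀ x : w'.adicCompletion (fixedField L),
              (∀ y : w'.adicCompletion (fixedField L), Valued.v y ≤ 1 → recordChar (fixedField L) (@vRat p hp) v w' ψ (x * y) = 1) ↔ Valued.v x ≤ 1) ∧
            (∀ [StarRing (w'.adicCompletion (fixedField L))],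
              (∀ z : w'.adicCompletion (fixedField L), IsLocalization.IsInteger (w'.adicCompletionIntegers (fixedField L)) z →
                IsLocalization.IsInteger (w'.adicCompletionIntegers (fixedField L)) (star z)) →
              ∀ x : Fin 3 → w'.adicCompletion (fixedField L),
                (∀ y ∈ stdLattice (w'.adicCompletionIntegers (fixedField L)),
                  recordChar (fixedField L) (@vRat p hp) v w' ψ
                    (sesqForm (((algebraMap (𝓞 (fixedField L)) (fixedField L)).mapMatrix (Matrix.diagonal ![1, 1, -1])).map (algebraMap (fixedField L) (w'.adicCompletion (fixedField L)))) x y) = 1) ↔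
                  x ∈ stdLattice (w'.adicCompletionIntegers (fixedField L))) ∧
            (letI := swapStarRing (w'.adicCompletion (fixedField L))
              ∀ x : Fin 3 → w'.adicCompletion (fixedField L) × w'.adicCompletion (fixedField L),
                (∀ y : Fin 3 → w'.adicCompletion (fixedField L) × w'.adicCompletion (fixedField L),
                  (∀ i, Valued.v (y i).1 ≤ 1 ∧ Valued.v (y i).2 ≤ 1) →
                  recordChar (fixedField L) (@vRat p hp) v w' ψ
                      (sesqForm (pairMatrix (((algebraMap (𝓞 (fixedField L)) (fixedField L)).mapMatrix (Matrix.diagonal ![1, 1, -1])).map (algebraMap (fixedField L) (w'.adicCompletion (fixedField L))))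
                        (((algebraMap (𝓞 (fixedField L)) (fixedField L)).mapMatrix (Matrix.diagonal ![1, 1, -1])).map (algebraMap (fixedField L) (w'.adicCompletion (fixedField L))))ᵀ) x y).1 *
                    recordChar (fixedField L) (@vRat p hp) v w' ψ
                      (sesqForm (pairMatrix (((algebraMap (𝓞 (fixedField L)) (fixedField L)).mapMatrix (Matrix.diagonal ![1, 1, -1])).map (algebraMap (fixedField L) (w'.adicCompletion (fixedField L))))
                        (((algebraMap (𝓞 (fixedField L)) (fixedField L)).mapMatrix (Matrix.diagonal ![1, 1, -1])).map (algebraMap (fixedField L) (w'.adicCompletion (fixedField L))))ᵀ) x y).2 = 1) ↔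
                  ∀ i, Valued.v (x i).1 ≤ 1 ∧ Valued.v (x i).2 ≤ 1)) ∧
        (∃ (θ : maximalRealSubfield (fixedField L)) (y : (fixedField L)) (hθ : algebraMap (maximalRealSubfield (fixedField L)) (fixedField L) θ = y ^ 2)
          (hy : complexConj (fixedField L) y ≠ y) (r : ℕ) (l : Fin r → 𝓞 (fixedField L))
          (_hl : Submodule.span (𝓞 (maximalRealSubfield (fixedField L))) (Set.range l) = ⊤),
          letI := tensorStarRing (fixedField L) v
          letI := starRingOfQuadratic (finrank_eq_two (fixedField L) v w hθ hy (not_isSquare_of_staysPrime (fixedField L) v w hθ hy hmap))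
            (localConj v w hθ.symm (span_pair_eq_top (fixedField L) hy) (not_isSquare_of_staysPrime (fixedField L) v w hθ hy hmap) (complexConj (fixedField L)))
            (localConj_ne_one v w hθ.symm (span_pair_eq_top (fixedField L) hy) (not_isSquare_of_staysPrime (fixedField L) v w hθ hy hmap)
              (complexConj (fixedField L)) (complexConj_apply_eq_neg (fixedField L) hθ hy))
          haveI := isDiscreteValuationRing_integralClosure_adicCompletion v w
          haveI := finite_residueField_integralClosure_adicCompletion v w
          haveI : IsFractionRing (integralClosure (v.adicCompletionIntegers (maximalRealSubfield (fixedField L))) (w.adicCompletion (fixedField L)))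
            (w.adicCompletion (fixedField L)) :=
            integralClosure.isFractionRing_of_finite_extension (v.adicCompletion (maximalRealSubfield (fixedField L)))
              (w.adicCompletion (fixedField L))
          ∃ (u₀ : (v.adicCompletionIntegers (maximalRealSubfield (fixedField L)))ˣ)
            (Φ : ↥(formUnitaryGroup (J3 (algebraMap (v.adicCompletionIntegers (maximalRealSubfield (fixedField L)))
              (w.adicCompletion (fixedField L)) (u₀ : v.adicCompletionIntegers (maximalRealSubfield (fixedField L)))))) ≃*
              ↥(formUnitaryGroup (tensorGram (fixedField L) v (gramToy (fixedField L)))))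
            (ϖ' : integralClosure (v.adicCompletionIntegers (maximalRealSubfield (fixedField L))) (w.adicCompletion (fixedField L)))
            (hϖ' : Irreducible ϖ')
            (hs' : star (algebraMap (integralClosure (v.adicCompletionIntegers (maximalRealSubfield (fixedField L)))
              (w.adicCompletion (fixedField L))) (w.adicCompletion (fixedField L)) ϖ') =
                algebraMap (integralClosure (v.adicCompletionIntegers (maximalRealSubfield (fixedField L))) (w.adicCompletion (fixedField L)))
                  (w.adicCompletion (fixedField L)) ϖ'),
            (∀ g, g ∈ hyperspecialSubgroup
                (integralClosure (v.adicCompletionIntegers (maximalRealSubfield (fixedField L))) (w.adicCompletion (fixedField L)))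
                (J3 (algebraMap (v.adicCompletionIntegers (maximalRealSubfield (fixedField L))) (w.adicCompletion (fixedField L))
                  (u₀ : v.adicCompletionIntegers (maximalRealSubfield (fixedField L))))) ↔ Φ g ∈ recordHyperspecial (fixedField L) v l (gramToy (fixedField L))) ∧
            ∀ {V : Type uV} [AddCommGroup V] [Module k V]
              (ρ : Representation k (↥(formUnitaryGroup (tensorGram (fixedField L) v (gramToy (fixedField L))))) V) [ρ.IsIrreducible],
              KFinite ρ (recordHyperspecial (fixedField L) v l (gramToy (fixedField L))) →
              ∀ [FiniteDimensional k (invariants ρ (recordHyperspecial (fixedField L) v l (gramToy (fixedField L))))],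
              invariants ρ (recordHyperspecial (fixedField L) v l (gramToy (fixedField L))) ≠ ⊥ →
              ∃ α : k, α ≠ 0 ∧ Nonempty (ρ.Equiv (comp Φ.symm
                (inertSphericalQuot
                  (hstar_of_star_eq (localConj v w hθ.symm (span_pair_eq_top (fixedField L) hy)
                    (not_isSquare_of_staysPrime (fixedField L) v w hθ hy hmap) (complexConj (fixedField L)))
                    (fun x => by rw [star_p8_eq_star (fixedField L) v w hθ hy (not_isSquare_of_staysPrime (fixedField L) v w hθ hy hmap)]; rfl))
                  (algebraMap (v.adicCompletionIntegers (maximalRealSubfield (fixedField L))) (w.adicCompletion (fixedField L))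
                    (u₀ : v.adicCompletionIntegers (maximalRealSubfield (fixedField L))))
                  (star_algebraMap_of_star_eq (localConj v w hθ.symm (span_pair_eq_top (fixedField L) hy)
                    (not_isSquare_of_staysPrime (fixedField L) v w hθ hy hmap) (complexConj (fixedField L)))
                    (fun x => by rw [star_p8_eq_star (fixedField L) v w hθ hy (not_isSquare_of_staysPrime (fixedField L) v w hθ hy hmap)]; rfl)
                    (u₀ : v.adicCompletionIntegers (maximalRealSubfield (fixedField L))))
                  (algebraMap_unit_ne_zero (F := v.adicCompletion (maximalRealSubfield (fixedField L))) u₀)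
                  (isInteger_algebraMap (u₀ : v.adicCompletionIntegers (maximalRealSubfield (fixedField L))))
                  (isInteger_algebraMap_unit_inv u₀) hϖ' hs' k (α * ((Ideal.absNorm v.asIdeal : k) ^ 2)⁻¹)))))}.Infinite :=
  haveI := isCMField_fixedField L
  haveI : Infinite {p : ℕ // p.Prime ∧ p % 21 = 2} := (infinite_setOf_prime_eq_mod 2 (by norm_num)).to_subtype
  Set.infinite_of_injective_forall_mem (vTwoModOf_injective L) fun p =>
    haveI hp : Fact p.1.Prime := ⟨p.2.1⟩
    (exists_map_eq_vTwoModOf L p).elim fun w hmap =>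
      ⟨p.1, hp, p.2.2, natCast_mem_vTwoModOf L p, w, hmap,
        @joint_outside_discriminant_of_staysPrime (fixedField L) _ _ (isCMField_fixedField L) (@vRat p.1 hp) (vTwoModOf L p)
          (@liesOver_vRat_of_mem p.1 hp _ _ _ (vTwoModOf L p) (natCast_mem_vTwoModOf L p))
          (@discr_fixedField_notMem L _ _ _ p.1 hp (not_dvd_twentyOne_of_two_mod p.1 p.2.2) (vTwoModOf L p)
            (liesOver_int_of_mem p.1 (vTwoModOf L p) (natCast_mem_vTwoModOf L p)))
          w (liesOver_of_map_eq (fixedField L) (vTwoModOf L p) w hmap) hmap k _ _ _⟩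

end TwentyOne

end Summit.Ventures.HodgeRepro2.T5RecordJointTwentyOneInfinitelyMany
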